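import Summits.KontsevichZagierPeriods.KontsevichZagierPeriods.Theorems.TerasomaMultiplicationBetaCancellationStubWeightLift

/-!
# `BetaCancellation` (stmt-KontsevichZagierPeriods-13633), line `dirichlet-companion-to-pi` — stub `stub_weight2Lift`

**Two-coordinate weight lift.** Let `h : ℝ → ℝ → ℝ` be a weight of the two disc coordinates such
that every representation `r = [t, f]` of dimension `k + 2 ≥ 2` has the weighted companion
`[t, h (z 0) (z 1) · f]`, let `P` be a pinned disc family of item 0540 (`P n r` = unit disc in the
coordinates `0, 1` times `r` in the trailing `n` coordinates), let `Dh = [piDisc, h (z 0) (z 1)]` be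
the weighted disc and let `M : FormalRep →+ FormalRep` be any additive endomorphism sending the
generator `[r]` of a representation of dimension `k + 2` to `[s]` whenever `s` is the weighted
companion of `r`. Then on the disc family the multiplier computes the weighted disc times `c`:
`[Dh] * c − M (lift (of ∘ P) c) ∈ relations`.

Proof. Both sides are additive in `c` (`FreeAbelianGroup.induction_on`). On a generator `[t]`
(`t : IntegralRep m`), `M [P m t] = [s]` for the weighted companion `s` of `P m t`, and `s` EQUALS the
reindexed product `(Dh × t).reindex (Fin (2 + m) ≃ Fin (m + 2))` (`KZ.IntegralRep.ext'`: same domain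
by the pinning, same integrand since the product integrand is `prodFun` unconditionally,
`KZ.IntegralRep.prod_integrand_eq`, the relabelling sending the two disc coordinates to `0, 1`);
finally `[Dh] * [t] = [Dh × t]` (`KZ.of_mul_of`) differs from its reindexing by one rule-(2) move
(`KZ.of_sub_of_reindex_mem_relations`). This is the one-coordinate `stub_weightLift` with the weight
`w (z 0)` replaced by `h (z 0) (z 1)`. No definitions; sorry-free;
axioms ⊆ {propext, Classical.choice, Quot.sound}.

References: M. Kontsevich, D. Zagier, *Periods* (2001), §1.2 rule (2), §4.1; J. Ayoub, *Une version
relative de la conjecture des périodes de Kontsevich–Zagier*, Ann. of Math. 181 (2015), §1.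
-/

noncomputable section

-- `Summit.KontsevichZagierPeriods.KontsevichZagierPeriods.…` is the tree's mandated layout (single-conjunct summit).
set_option linter.dupNamespace false

namespace Summit.KontsevichZagierPeriods.KontsevichZagierPeriods.BetaCancellationLine

open Set
open Literature.NumberTheory.Transcendental
open Literature.NumberTheory.Transcendental.KZ

/-! ### The two-coordinate weighted companion of the pinned family is the reindexed `Dh × t` -/

/-- **The `h`-weighted companion of the pinned family is the reindexed `Dh × t`**: if `s` has the
domain of `P m t` and integrand `h (z 0) (z 1) · (P m t).integrand z`, and `Dh` has domain `piDisc`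
and integrand `h (z 0) (z 1)`, then `s = (Dh × t).reindex (Fin (2 + m) ≃ Fin (m + 2))`
(`KZ.IntegralRep.ext'`). [folklore] -/
theorem weight2Lift_pinned_eq_reindex (h : ℝ → ℝ → ℝ)
    (P : ∀ n : ℕ, IntegralRep n → IntegralRep (n + 2))
    (hP : ∀ (n : ℕ) (r : IntegralRep n),
      (P n r).domain = {z : Fin (n + 2) → ℝ | z 0 ^ 2 + z 1 ^ 2 ≤ 1 ∧ (fun i : Fin n => z i.succ.succ) ∈ r.domain} ∧
      (P n r).integrand = fun z => r.integrand (fun i : Fin n => z i.succ.succ))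
    {Dh : IntegralRep 2} (hDh : Dh.domain = piDisc) (hDh1 : Dh.integrand = fun z => h (z 0) (z 1))
    (m : ℕ) (t : IntegralRep m) {s : IntegralRep (m + 2)}
    (hs : s.domain = (P m t).domain)
    (hsi : s.integrand = fun z => h (z 0) (z 1) * (P m t).integrand z) :
    s = (Dh.prod t).reindex (finCongr (Nat.add_comm 2 m)) := by
  refine IntegralRep.ext' ?_ ?_
  · rw [hs]
    ext z
    simp only [(hP m t).1, IntegralRep.reindex_domain, IntegralRep.prod_domain,
      IntegralRep.mem_prodDomain, hDh, mem_setOf_eq, mem_piDisc,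
      piIndex_castAdd_zero, piIndex_castAdd_one, piIndex_natAdd]
  · rw [hsi]
    funext z
    simp only [(hP m t).2, IntegralRep.reindex_integrand, IntegralRep.prod_integrand_eq,
      IntegralRep.prodFun, hDh1, piIndex_castAdd_zero, piIndex_castAdd_one, piIndex_natAdd]

/-! ### Two-coordinate weight lift: on the disc family the multiplier computes `[Dh] * c` -/

/-- **Two-coordinate weight lift**: on the pinned disc family the multiplier computes the weighted
disc times `c`: `[D, h(x, y)] * c − M (lift (of ∘ P) c) ∈ relations` (both sides additive in `c`; on
a generator `[t]`, `M [P t]` is the reindexed `[D_h × t] = [D_h] * [t]`, one rule-(2) relabelling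
`KZ.of_sub_of_reindex_mem_relations`). [folklore] -/
theorem stub_weight2Lift :
    ∀ (h : ℝ → ℝ → ℝ),
    (∀ (k : ℕ) (r : IntegralRep (k + 2)),
      ∃ s : IntegralRep (k + 2), s.domain = r.domain ∧
        s.integrand = fun z => h (z 0) (z 1) * r.integrand z) →
    ∀ (P : ∀ n : ℕ, IntegralRep n → IntegralRep (n + 2)),
      (∀ (n : ℕ) (r : IntegralRep n), (P n r).domain = {z : Fin (n + 2) → ℝ | z 0 ^ 2 + z 1 ^ 2 ≤ 1 ∧ (fun i : Fin n => z i.succ.succ) ∈ r.domain} ∧ (P n r).integrand = fun z => r.integrand (fun i : Fin n => z i.succ.succ)) →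
    ∀ (Dh : IntegralRep 2), Dh.domain = piDisc → (Dh.integrand = fun z => h (z 0) (z 1)) →
    ∀ (M : FormalRep →+ FormalRep),
      (∀ (k : ℕ) (r s : IntegralRep (k + 2)), s.domain = r.domain →
          (s.integrand = fun z => h (z 0) (z 1) * r.integrand z) → M (of r) = of s) →
      ∀ c : FormalRep,
        of Dh * c - M (FreeAbelianGroup.lift (fun s : (Σ n, IntegralRep n) => of (P s.1 s.2)) c) ∈
          relations := by
  intro h hex P hP Dh hDh hDh1 M hpin c
  induction c using FreeAbelianGroup.induction_on with
  | zero => simp [relations.zero_mem]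
  | of x =>
    obtain ⟨m, t⟩ := x
    rw [FreeAbelianGroup.lift_apply_of]
    obtain ⟨s, hs, hsi⟩ := hex m (P m t)
    change of Dh * of t - M (of (P m t)) ∈ relations
    rw [hpin m (P m t) s hs hsi, weight2Lift_pinned_eq_reindex h P hP hDh hDh1 m t hs hsi,
      of_mul_of]
    exact of_sub_of_reindex_mem_relations _ _
  | neg x ih =>
    rw [mul_neg, map_neg, map_neg, ← neg_sub']
    exact relations.neg_mem ih
  | add x y hx hy =>
    rw [mul_add, map_add, map_add, ← sub_add_sub_comm]
    exact relations.add_mem hx hy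

end Summit.KontsevichZagierPeriods.KontsevichZagierPeriods.BetaCancellationLine
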